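import Summits.PneNP.PneNP.Theorems.ChebyshevTracialDesignTightEvenEigenvalues
import Summits.PneNP.PneNP.Theorems.ChebyshevTracialDesignDipoleNormClosedForm
import Summits.PneNP.PneNP.Theorems.ChebyshevTracialDesignDipoleHitRatio
import HarnessLib

/-!
# Cell pnp-psdrank, route `ChebyshevTracialDesign`: the even ladder eigenvalues of the tight Gram kernel, SUM-FREE closed form

Harmonic backbone of the `r = 1` rung of the crux `TracialDecayExp20` (stmt-PneNP-19878). Prover g5's (★★)
`…TightEvenEigenvalues.kernelEigen_tight_even_eq` (p444684) expresses `λ_{2κ'}` of the tight incidence on the `t`-subsets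
(`t = 2c+1`, `2t ≤ n`) through the `d`-sum `Σ_{d even} C(2κ',d) pm(2κ'−d) pm(d)² pm(n−2κ'−d)` and the ladder product
`Π_{i<t−2κ'} λ_{2κ'}(i)`; with the closed form (S) of the `d`-sum (`…DipoleNormClosedForm.sum_even_block_pmCount_eq`, this seat,
p447718, via the prover's rising Vandermonde) and the closed form of the ladder product (`…DipoleHitRatio.prod_ladder_eq`, p447163:
`((t−2κ')!)²·C(n−4κ', t−2κ')`) both disappear:
* `kernelEigen_tight_even_closed` : for even `n`, `t = 2c+1`, `2t ≤ n`, `κ' ≤ c`,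
  `kernelEigen n t (2κ') κ = ((n−2c−2κ')·C(n/2−2κ', c−κ'))² · pm(2κ')·pm(n−4κ')·Π_{i<κ'}(n−2κ'−2i) / C(n−4κ', t−2κ')`
  (check `(10,5,κ'=1)`: `(10−4−2)²·C(3,1)²·1·15·8/C(6,3) = 16·9·120/20 = 864` ✓ brute force).
From here MEMO-7(prover) §E (P) — `λ_{2κ'}/λ₀ = (2κ'−1)‼·Π_{i<κ'}(t−1−2i)(n−t−1−2i)/((t−2i)(n−t−2i)(n−2i))`, the monotone decay
`λ_{2κ'+2}/λ_{2κ'} < (2κ'+1)/(n−2κ')` and the σ₂ tail — is pure arithmetic on this expression (next file; not done here).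
[cite: GodsilMeagher2015, §15.2 (perfect matching scheme)] WHAT THIS IS NOT: not (P), nothing on psd rank. Supports crux stmt-PneNP-19878.
-/

set_option linter.dupNamespace false -- `Summit.PneNP.PneNP.…`: summit = sub-problem (D-0017)

noncomputable section

namespace Summit.PneNP.PneNP.Theorems.ChebyshevTracialDesignTightEvenClosedForm

open Finset Literature.Barriers.PneNP Literature.Combinatorics.AssociationSchemes
open Literature.Combinatorics.AssociationSchemes.JohnsonHarmonics
open Literature.Combinatorics.AssociationSchemes.JohnsonSpectrum
open Summit.PneNP.PneNP.Theorems.ChebyshevTracialDesignTightEvenEigenvalues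
open Summit.PneNP.PneNP.Theorems.ChebyshevTracialDesignDipoleNormClosedForm
open Summit.PneNP.PneNP.Theorems.ChebyshevTracialDesignDipoleHitRatio

variable {n : ℕ}

/-- **(★★) without sums or ladder products.** For even `n`, `t = 2c+1` with `2t ≤ n`, `κ' ≤ c`, and `κ` the Gram class
function of the tight incidence on the `t`-subsets:
`kernelEigen n t (2κ') κ = ((n−2c−2κ')·C(n/2−2κ', c−κ'))²·pm(2κ')·pm(n−4κ')·Π_{i<κ'}(n−2κ'−2i) / C(n−4κ', t−2κ')`.
[cite: GodsilMeagher2015, §15.2] -/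
theorem kernelEigen_tight_even_closed {c κ' : ℕ} (hn : Even n) (ht : 2 * (2 * c + 1) ≤ n) (hκc : κ' ≤ c) (κ : ℕ → ℝ)
    (hA : ∀ U ∈ univ.powersetCard (2 * c + 1), ∀ U' ∈ univ.powersetCard (2 * c + 1),
      ∑ M : PMatch n, (if (U.filter fun x => M.2.partner x ∉ U).card = 1 then (1 : ℝ) else 0) *
        (if (U'.filter fun x => M.2.partner x ∉ U').card = 1 then (1 : ℝ) else 0) = κ (U ∩ U').card) :
    kernelEigen n (2 * c + 1) (2 * κ') κ =
      (((n : ℝ) - (2 * c : ℕ) - (2 * κ' : ℕ)) * (((n / 2 - 2 * κ').choose (c - κ') : ℕ) : ℝ)) ^ 2 *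
        ((pmCount (2 * κ') : ℝ) * pmCount (n - 4 * κ') * ∏ i ∈ range κ', ((n : ℝ) - 2 * κ' - 2 * i)) /
        (((n - 4 * κ').choose (2 * c + 1 - 2 * κ') : ℕ) : ℝ) := by
  rw [kernelEigen_tight_even_eq ht hκc κ hA, sum_even_block_pmCount_eq hn (by omega),
    prod_ladder_eq (n := n) (j := 2 * κ') (m := 2 * c + 1 - 2 * κ') (by omega),
    show n - 2 * (2 * κ') = n - 4 * κ' by omega]
  have hf : (0 : ℝ) < ((2 * c + 1 - 2 * κ').factorial : ℕ) := by exact_mod_cast Nat.factorial_pos _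
  have hch : (0 : ℝ) < (((n - 4 * κ').choose (2 * c + 1 - 2 * κ') : ℕ) : ℝ) := by
    exact_mod_cast Nat.choose_pos (by omega)
  field_simp

end Summit.PneNP.PneNP.Theorems.ChebyshevTracialDesignTightEvenClosedForm
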